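/-
Copyright (c) 2026 the pub-hodgecm-mathlib formalisation cell (harness21).  Prover seat hodgecm-mathlib-LH5-p04 (g6), line LH5 (closer stub
`stub_S1finTFCovol`), glue brick (g5) «ARCH BLOCK MODEL AT THE IDENTITY FRAME» of the (M-Z1♭-RED) glue list (census 7285f7ff §2); 2026-09-02.
-/
import Literature.NumberTheory.Weil1964.UnitaryArchSingularCentralizerTopFormHaarFrames   -- ★ B2a/B2b: `centralizerTopFormHaar`, `IsSingularArchFrame`, frame independence :495
import HarnessLib

/-!
# The top-form Haar measure of the archimedean centraliser in the BLOCK MODEL: at the identity frame it IS `|ω_std|_{M₂} ⊗ |ω_std|_{M₁}` pushed along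
# `(u₁, u₂) ↦ u₁ ⊕ᶠ u₂` (Rogawski 1990 §3.8 Prop. 3.8.1 (a) p. 27, §1.7 p. 6 «compatible measures»)

Topic `NumberTheory/Weil1964`; namespace `Literature.NumberTheory.Weil1964.UnitaryArchTopForm`.  THEOREMS ONLY (no definition, no instance, no notation, no named fact,
no `sorry`).  Sequel of ★ B2a `UnitaryArchSingularCentralizerTopFormHaar` (`archBlockDiag`, `archFrameEmbedding T`, `centralizerMeasureOfFrame`, `IsSingularArchFrame`,
`centralizerTopFormHaar := the frame measure of a CHOSEN frame`) and ★ B2b `…Frames` (`centralizerTopFormHaar_eq_centralizerMeasureOfFrame`: ANY frame computes it).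

WHAT IS NEW.  In the BLOCK MODEL — Gram matrix literally `H = H_a ⊕ᶠ H_b`, element literally `γ = (a·1₂ ⊕ᶠ b·1₁)′` — the IDENTITY `T = 1` is a singular archimedean frame with the GIVEN
blocks `H_a, H_b`, so the `choose` inside `centralizerTopFormHaar` disappears: the measure is the push-forward of `archTopFormHaar H_a ⊗ archTopFormHaar H_b` along the block-diagonal
embedding `archBlockDiag` itself (no conjugation), and its value on a measurable set is the product measure of the preimage.  This is the archimedean factor a consumer
comparing two block models needs (the Z1♭ ⟸ Z1♭♭ junction of the LH5 line reads `centralizerTopFormHaar L (Ha ⊕ᶠ Hb) (archPart (toAdelic γ₀))`); §3 supplies the matrix letter of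
that element.

* §1 (generic `F, E, c`, sizes `N₁ + N₂`, `J₁, J₂`; `γ ∈ U(J₁ ⊕ᶠ J₂)(E ⊗ ℝ)` with matrix `a·1 ⊕ᶠ b·1`, `a b : E ⊗ ℝ`) `archBlockDiag_mem_centralizer_of_coe_eq_finSum`
  (★ `finSum_commute_finSum_smul_one`); `archFrameEmbedding_one_apply` (`archFrameEmbedding 1 _ = archBlockDiag`, `1·x·1⁻¹ = x`); `centralizerMeasureOfFrame_one_eq_map_archBlockDiag`.
* §2 (CM: `L`, blocks `Ha ∈ M₂(L)`, `Hb ∈ M₁(L)` `c`-hermitian with unit determinants, `a ≠ b ∈ L`, `γ ∈ U(Ha ⊕ᶠ Hb)(L⁺ ⊗ ℝ)` with matrix `(a·1 ⊕ᶠ b·1)′`)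
  **`isSingularArchFrame_one_of_coe_eq_finSum`** (`T = 1` is a frame, ★ `formCongr_one_eq`); **`centralizerTopFormHaar_eq_map_archBlockDiag`** and its measurable-set form
  `centralizerTopFormHaar_apply_eq_prod_preimage`; `isHaarMeasure_centralizerTopFormHaar_of_coe_eq_finSum`.
* §3 (CM, any `N`, `H`) `coe_coe_archPart_cmDatum_toAdelic` — the matrix of `archPart (toAdelic γ₀)` is `γ₀.map mixedEmbedding` (entrywise Mathlib
  `InfiniteAdeleRing.mixedEmbedding_eq_algebraMap_comp`, as ★ `archPart_toAdelic`); block model: `coe_coe_archPart_cmDatum_toAdelic_of_eq_finSum` — it is `(a·1 ⊕ᶠ b·1)′`, so §2 applies to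
  Z1♭'s archimedean brick verbatim.
HONEST LABEL: count-neutral glue (no covolume identity, no organ of the LH5 line paid; Z1♭'s print floor [Kottwitz1988 Thm 1] untouched); HC_CM is proved only modulo the printed citations
until rung 0 closes.

## References
* J. D. Rogawski, *Automorphic Representations of Unitary Groups in Three Variables*, Ann. of Math. Stud. 123 (1990), §1.7 p. 6; §3.8 Prop. 3.8.1 (a) p. 27; §14.5 Lemma 14.5.2 (b)
  pp. 238–239. [Rogawski1990]
* A. Borel, H. Jacquet, *Automorphic forms and automorphic representations*, Proc. Sympos. Pure Math. 33 Part 1 (1979), §4.1 (`G(𝔸) = G_∞ × G(𝔸_f)`). [BorelJacquet1979]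
-/

set_option autoImplicit false

noncomputable section

open NumberField NumberField.mixedEmbedding NumberField.InfinitePlace Set Topology MeasureTheory MeasureTheory.Measure
open Literature.NumberTheory.Automorphic Literature.NumberTheory.Automorphic.UnitaryGroup
open scoped Matrix MatrixGroups ENNReal NNReal

namespace Literature.NumberTheory.Weil1964

namespace UnitaryArchTopForm

/-! ## §1 Generic: the identity frame of the block model -/

section Frame

variable {F E : Type} [Field F] [Field E] [Algebra F E] {c : E ≃ₐ[F] E} {N₁ N₂ : ℕ}
  {J₁ : Matrix (Fin N₁) (Fin N₁) E} {J₂ : Matrix (Fin N₂) (Fin N₂) E}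

/-- **Block-diagonal elements centralise a block scalar** in `U(J₁ ⊕ᶠ J₂)(E ⊗ ℝ)`: if the matrix of `γ` is `a·1 ⊕ᶠ b·1` then every `u₁ ⊕ᶠ u₂` commutes with `γ`
(★ `finSum_commute_finSum_smul_one`). [cite: Rogawski1990, §3.8 Prop. 3.8.1 p. 27] -/
theorem archBlockDiag_mem_centralizer_of_coe_eq_finSum {a b : mixedSpace E} (γ : arch F E c (N₁ + N₂) (finSum N₁ N₂ J₁ J₂))
    (hγ : ((γ : GL (Fin (N₁ + N₂)) (mixedSpace E)) : Matrix (Fin (N₁ + N₂)) (Fin (N₁ + N₂)) (mixedSpace E)) =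
      finSum N₁ N₂ (a • (1 : Matrix (Fin N₁) (Fin N₁) (mixedSpace E))) (b • 1))
    (u : arch F E c N₁ J₁ × arch F E c N₂ J₂) :
    archBlockDiag F E c J₁ J₂ u ∈ Subgroup.centralizer ({γ} : Set (arch F E c (N₁ + N₂) (finSum N₁ N₂ J₁ J₂))) := by
  rw [Subgroup.mem_centralizer_singleton_iff]
  apply Subtype.ext
  apply Units.ext
  rw [Subgroup.coe_mul, Subgroup.coe_mul, Units.val_mul, Units.val_mul, hγ, coe_coe_archBlockDiag]
  exact finSum_commute_finSum_smul_one a b _ _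

/-- **At the identity frame the frame embedding IS the block-diagonal embedding**: `archFrameEmbedding 1 _ u = archBlockDiag u` (`1 · (u₁ ⊕ᶠ u₂) · 1⁻¹ = u₁ ⊕ᶠ u₂`).
[cite: Rogawski1990, §3.8 Prop. 3.8.1 p. 27] -/
theorem archFrameEmbedding_one_apply
    (hT : formCongr (conjMixed F E c) (1 : GL (Fin (N₁ + N₂)) (mixedSpace E)) (archFormOf E (N₁ + N₂) (finSum N₁ N₂ J₁ J₂)) =
      archFormOf E (N₁ + N₂) (finSum N₁ N₂ J₁ J₂))
    (u : arch F E c N₁ J₁ × arch F E c N₂ J₂) :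
    archFrameEmbedding (J := finSum N₁ N₂ J₁ J₂) 1 hT u = archBlockDiag F E c J₁ J₂ u := by
  apply Subtype.ext
  rw [coe_archFrameEmbedding, inv_one, mul_one, one_mul]

/-- **The frame measure of the identity frame is the push-forward of `μ₁ ⊗ μ₂` along `archBlockDiag`** (with values in the centraliser).
[cite: Rogawski1990, §1.7 p. 6; §3.8 Prop. 3.8.1 (a) p. 27] -/
theorem centralizerMeasureOfFrame_one_eq_map_archBlockDiag
    (hT : formCongr (conjMixed F E c) (1 : GL (Fin (N₁ + N₂)) (mixedSpace E)) (archFormOf E (N₁ + N₂) (finSum N₁ N₂ J₁ J₂)) =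
      archFormOf E (N₁ + N₂) (finSum N₁ N₂ J₁ J₂))
    {a b : mixedSpace E} (γ : arch F E c (N₁ + N₂) (finSum N₁ N₂ J₁ J₂))
    (hγ1 : ((γ : GL (Fin (N₁ + N₂)) (mixedSpace E)) : Matrix (Fin (N₁ + N₂)) (Fin (N₁ + N₂)) (mixedSpace E)) *
        ((1 : GL (Fin (N₁ + N₂)) (mixedSpace E)) : Matrix (Fin (N₁ + N₂)) (Fin (N₁ + N₂)) (mixedSpace E)) =
      ((1 : GL (Fin (N₁ + N₂)) (mixedSpace E)) : Matrix (Fin (N₁ + N₂)) (Fin (N₁ + N₂)) (mixedSpace E)) *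
        finSum N₁ N₂ (a • (1 : Matrix (Fin N₁) (Fin N₁) (mixedSpace E))) (b • 1))
    (hγ : ((γ : GL (Fin (N₁ + N₂)) (mixedSpace E)) : Matrix (Fin (N₁ + N₂)) (Fin (N₁ + N₂)) (mixedSpace E)) =
      finSum N₁ N₂ (a • (1 : Matrix (Fin N₁) (Fin N₁) (mixedSpace E))) (b • 1))
    [MeasurableSpace (arch F E c N₁ J₁)] [MeasurableSpace (arch F E c N₂ J₂)]
    [MeasurableSpace (Subgroup.centralizer ({γ} : Set (arch F E c (N₁ + N₂) (finSum N₁ N₂ J₁ J₂))))]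
    (μ₁ : Measure (arch F E c N₁ J₁)) (μ₂ : Measure (arch F E c N₂ J₂)) :
    centralizerMeasureOfFrame (J := finSum N₁ N₂ J₁ J₂) 1 hT γ hγ1 μ₁ μ₂ =
      Measure.map (fun u : arch F E c N₁ J₁ × arch F E c N₂ J₂ =>
        (⟨archBlockDiag F E c J₁ J₂ u, archBlockDiag_mem_centralizer_of_coe_eq_finSum γ hγ u⟩ :
          Subgroup.centralizer ({γ} : Set (arch F E c (N₁ + N₂) (finSum N₁ N₂ J₁ J₂))))) (μ₁.prod μ₂) := by
  rw [centralizerMeasureOfFrame_def]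
  congr 1
  funext u
  exact Subtype.ext (archFrameEmbedding_one_apply hT u)

end Frame

/-! ## §2 CM: `centralizerTopFormHaar` in the block model -/

section CM

variable {L : Type} [Field L] [NumberField L] [IsCMField L] {Ha : Matrix (Fin 2) (Fin 2) L} {Hb : Matrix (Fin 1) (Fin 1) L} {a b : L}

/-- **The identity is a singular archimedean frame of the block model**: for `c`-hermitian blocks `Ha ∈ M₂(L)`, `Hb ∈ M₁(L)` with unit determinants, `a ≠ b`,
and `γ ∈ U(Ha ⊕ᶠ Hb)(L⁺ ⊗ ℝ)` whose matrix IS `(a·1 ⊕ᶠ b·1)′`, `IsSingularArchFrame L (Ha ⊕ᶠ Hb) γ a b 1 Ha Hb` (congruence by `1` is the identity, ★ `formCongr_one_eq`).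
[cite: Rogawski1990, §3.8 Prop. 3.8.1 (a) p. 27] -/
theorem isSingularArchFrame_one_of_coe_eq_finSum (hHa : (Ha.map (IsCMField.complexConj L))ᵀ = Ha) (hHb : (Hb.map (IsCMField.complexConj L))ᵀ = Hb)
    (hda : IsUnit Ha.det) (hdb : IsUnit Hb.det) (hab : a ≠ b)
    (γ : arch (↥(maximalRealSubfield L)) L (IsCMField.complexConj L) 3 (finSum 2 1 Ha Hb))
    (hγ : ((γ : GL (Fin 3) (mixedSpace L)) : Matrix (Fin 3) (Fin 3) (mixedSpace L)) =
      finSum 2 1 (mixedEmbedding L a • (1 : Matrix (Fin 2) (Fin 2) (mixedSpace L))) (mixedEmbedding L b • 1)) :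
    IsSingularArchFrame L (finSum 2 1 Ha Hb) γ a b 1 Ha Hb := by
  refine ⟨hab, hHa, hHb, hda, hdb, formCongr_one_eq _ _, ?_⟩
  rw [hγ, Units.val_one, Matrix.mul_one, Matrix.one_mul]

/-- **THE ARCHIMEDEAN BRICK OF THE BLOCK MODEL**: under the hypotheses of `isSingularArchFrame_one_of_coe_eq_finSum`, the top-form Haar measure of the centraliser
`Z(γ) ⊂ U(Ha ⊕ᶠ Hb)(L⁺ ⊗ ℝ)` IS the push-forward of `archTopFormHaar Ha ⊗ archTopFormHaar Hb` (`= |ω_std|_{M₂} ⊗ |ω_std|_{M₁}`) along the block-diagonal embedding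
`(u₁, u₂) ↦ u₁ ⊕ᶠ u₂` — ★ `centralizerTopFormHaar_eq_centralizerMeasureOfFrame` at the frame `T = 1`, whose embedding is `archBlockDiag` (§1).  No frame is chosen, no
conjugation appears: the GIVEN blocks carry the measure. [cite: Rogawski1990, §1.7 p. 6; §3.8 Prop. 3.8.1 (a) p. 27; §14.5 Lemma 14.5.2 (b) pp. 238–239] -/
theorem centralizerTopFormHaar_eq_map_archBlockDiag (hHa : (Ha.map (IsCMField.complexConj L))ᵀ = Ha) (hHb : (Hb.map (IsCMField.complexConj L))ᵀ = Hb)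
    (hda : IsUnit Ha.det) (hdb : IsUnit Hb.det) (hab : a ≠ b)
    (γ : arch (↥(maximalRealSubfield L)) L (IsCMField.complexConj L) 3 (finSum 2 1 Ha Hb))
    (hγ : ((γ : GL (Fin 3) (mixedSpace L)) : Matrix (Fin 3) (Fin 3) (mixedSpace L)) =
      finSum 2 1 (mixedEmbedding L a • (1 : Matrix (Fin 2) (Fin 2) (mixedSpace L))) (mixedEmbedding L b • 1))
    [MeasurableSpace (Subgroup.centralizer ({γ} : Set (arch (↥(maximalRealSubfield L)) L (IsCMField.complexConj L) 3 (finSum 2 1 Ha Hb))))]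
    [BorelSpace (Subgroup.centralizer ({γ} : Set (arch (↥(maximalRealSubfield L)) L (IsCMField.complexConj L) 3 (finSum 2 1 Ha Hb))))]
    [MeasurableSpace (arch (↥(maximalRealSubfield L)) L (IsCMField.complexConj L) 2 Ha)] [BorelSpace (arch (↥(maximalRealSubfield L)) L (IsCMField.complexConj L) 2 Ha)]
    [MeasurableSpace (archSkew (↥(maximalRealSubfield L)) L (IsCMField.complexConj L) 2 Ha)] [BorelSpace (archSkew (↥(maximalRealSubfield L)) L (IsCMField.complexConj L) 2 Ha)]
    [MeasurableSpace (arch (↥(maximalRealSubfield L)) L (IsCMField.complexConj L) 1 Hb)] [BorelSpace (arch (↥(maximalRealSubfield L)) L (IsCMField.complexConj L) 1 Hb)]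
    [MeasurableSpace (archSkew (↥(maximalRealSubfield L)) L (IsCMField.complexConj L) 1 Hb)] [BorelSpace (archSkew (↥(maximalRealSubfield L)) L (IsCMField.complexConj L) 1 Hb)] :
    centralizerTopFormHaar L (finSum 2 1 Ha Hb) γ =
      Measure.map (fun u : arch (↥(maximalRealSubfield L)) L (IsCMField.complexConj L) 2 Ha × arch (↥(maximalRealSubfield L)) L (IsCMField.complexConj L) 1 Hb =>
          (⟨archBlockDiag (↥(maximalRealSubfield L)) L (IsCMField.complexConj L) Ha Hb u, archBlockDiag_mem_centralizer_of_coe_eq_finSum γ hγ u⟩ :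
            Subgroup.centralizer ({γ} : Set (arch (↥(maximalRealSubfield L)) L (IsCMField.complexConj L) 3 (finSum 2 1 Ha Hb)))))
        ((archTopFormHaar (↥(maximalRealSubfield L)) L (IsCMField.complexConj L) 2 Ha).prod
          (archTopFormHaar (↥(maximalRealSubfield L)) L (IsCMField.complexConj L) 1 Hb)) := by
  have hfr := isSingularArchFrame_one_of_coe_eq_finSum hHa hHb hda hdb hab γ hγ
  rw [centralizerTopFormHaar_eq_centralizerMeasureOfFrame hfr]
  exact centralizerMeasureOfFrame_one_eq_map_archBlockDiag (N₁ := 2) (N₂ := 1) hfr.formCongr_eq γ hfr.mul_eq hγ _ _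

/-- **Measurable-set form**: `centralizerTopFormHaar (Ha ⊕ᶠ Hb) γ S = (archTopFormHaar Ha ⊗ archTopFormHaar Hb) ((u ↦ u₁ ⊕ᶠ u₂) ⁻¹' S)` for measurable `S ⊆ Z(γ)` — the mass of a
box of the archimedean centraliser is computed on the blocks. [cite: Rogawski1990, §1.7 p. 6; §3.8 Prop. 3.8.1 (a) p. 27] -/
theorem centralizerTopFormHaar_apply_eq_prod_preimage (hHa : (Ha.map (IsCMField.complexConj L))ᵀ = Ha) (hHb : (Hb.map (IsCMField.complexConj L))ᵀ = Hb)
    (hda : IsUnit Ha.det) (hdb : IsUnit Hb.det) (hab : a ≠ b)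
    (γ : arch (↥(maximalRealSubfield L)) L (IsCMField.complexConj L) 3 (finSum 2 1 Ha Hb))
    (hγ : ((γ : GL (Fin 3) (mixedSpace L)) : Matrix (Fin 3) (Fin 3) (mixedSpace L)) =
      finSum 2 1 (mixedEmbedding L a • (1 : Matrix (Fin 2) (Fin 2) (mixedSpace L))) (mixedEmbedding L b • 1))
    [MeasurableSpace (Subgroup.centralizer ({γ} : Set (arch (↥(maximalRealSubfield L)) L (IsCMField.complexConj L) 3 (finSum 2 1 Ha Hb))))]
    [BorelSpace (Subgroup.centralizer ({γ} : Set (arch (↥(maximalRealSubfield L)) L (IsCMField.complexConj L) 3 (finSum 2 1 Ha Hb))))]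
    [MeasurableSpace (arch (↥(maximalRealSubfield L)) L (IsCMField.complexConj L) 2 Ha)] [BorelSpace (arch (↥(maximalRealSubfield L)) L (IsCMField.complexConj L) 2 Ha)]
    [MeasurableSpace (archSkew (↥(maximalRealSubfield L)) L (IsCMField.complexConj L) 2 Ha)] [BorelSpace (archSkew (↥(maximalRealSubfield L)) L (IsCMField.complexConj L) 2 Ha)]
    [MeasurableSpace (arch (↥(maximalRealSubfield L)) L (IsCMField.complexConj L) 1 Hb)] [BorelSpace (arch (↥(maximalRealSubfield L)) L (IsCMField.complexConj L) 1 Hb)]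
    [MeasurableSpace (archSkew (↥(maximalRealSubfield L)) L (IsCMField.complexConj L) 1 Hb)] [BorelSpace (archSkew (↥(maximalRealSubfield L)) L (IsCMField.complexConj L) 1 Hb)]
    {S : Set (Subgroup.centralizer ({γ} : Set (arch (↥(maximalRealSubfield L)) L (IsCMField.complexConj L) 3 (finSum 2 1 Ha Hb))))} (hS : MeasurableSet S) :
    centralizerTopFormHaar L (finSum 2 1 Ha Hb) γ S =
      ((archTopFormHaar (↥(maximalRealSubfield L)) L (IsCMField.complexConj L) 2 Ha).prod
          (archTopFormHaar (↥(maximalRealSubfield L)) L (IsCMField.complexConj L) 1 Hb))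
        ((fun u : arch (↥(maximalRealSubfield L)) L (IsCMField.complexConj L) 2 Ha × arch (↥(maximalRealSubfield L)) L (IsCMField.complexConj L) 1 Hb =>
          (⟨archBlockDiag (↥(maximalRealSubfield L)) L (IsCMField.complexConj L) Ha Hb u, archBlockDiag_mem_centralizer_of_coe_eq_finSum γ hγ u⟩ :
            Subgroup.centralizer ({γ} : Set (arch (↥(maximalRealSubfield L)) L (IsCMField.complexConj L) 3 (finSum 2 1 Ha Hb))))) ⁻¹' S) := by
  haveI : BorelSpace (arch (↥(maximalRealSubfield L)) L (IsCMField.complexConj L) 2 Ha × arch (↥(maximalRealSubfield L)) L (IsCMField.complexConj L) 1 Hb) :=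
    Prod.borelSpace
  have hmeas : Measurable (fun u : arch (↥(maximalRealSubfield L)) L (IsCMField.complexConj L) 2 Ha × arch (↥(maximalRealSubfield L)) L (IsCMField.complexConj L) 1 Hb =>
      (⟨archBlockDiag (↥(maximalRealSubfield L)) L (IsCMField.complexConj L) Ha Hb u, archBlockDiag_mem_centralizer_of_coe_eq_finSum γ hγ u⟩ :
        Subgroup.centralizer ({γ} : Set (arch (↥(maximalRealSubfield L)) L (IsCMField.complexConj L) 3 (finSum 2 1 Ha Hb))))) :=
    ((continuous_archBlockDiag (↥(maximalRealSubfield L)) L (IsCMField.complexConj L) Ha Hb).subtype_mk _).measurable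
  rw [centralizerTopFormHaar_eq_map_archBlockDiag hHa hHb hda hdb hab γ hγ, Measure.map_apply hmeas hS]

/-- **`centralizerTopFormHaar` of the block model is a Haar measure** (★ `isHaarMeasure_centralizerTopFormHaar` at the identity frame).
[cite: Rogawski1990, §1.7 p. 6; §3.8 Prop. 3.8.1 (a) p. 27] -/
theorem isHaarMeasure_centralizerTopFormHaar_of_coe_eq_finSum (hHa : (Ha.map (IsCMField.complexConj L))ᵀ = Ha) (hHb : (Hb.map (IsCMField.complexConj L))ᵀ = Hb)
    (hda : IsUnit Ha.det) (hdb : IsUnit Hb.det) (hab : a ≠ b)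
    (γ : arch (↥(maximalRealSubfield L)) L (IsCMField.complexConj L) 3 (finSum 2 1 Ha Hb))
    (hγ : ((γ : GL (Fin 3) (mixedSpace L)) : Matrix (Fin 3) (Fin 3) (mixedSpace L)) =
      finSum 2 1 (mixedEmbedding L a • (1 : Matrix (Fin 2) (Fin 2) (mixedSpace L))) (mixedEmbedding L b • 1))
    [MeasurableSpace (Subgroup.centralizer ({γ} : Set (arch (↥(maximalRealSubfield L)) L (IsCMField.complexConj L) 3 (finSum 2 1 Ha Hb))))]
    [BorelSpace (Subgroup.centralizer ({γ} : Set (arch (↥(maximalRealSubfield L)) L (IsCMField.complexConj L) 3 (finSum 2 1 Ha Hb))))] :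
    (centralizerTopFormHaar L (finSum 2 1 Ha Hb) γ).IsHaarMeasure :=
  isHaarMeasure_centralizerTopFormHaar (isSingularArchFrame_one_of_coe_eq_finSum hHa hHb hda hdb hab γ hγ)

end CM

/-! ## §3 The block-model element `archPart (toAdelic γ₀)`: its matrix is `(a·1 ⊕ᶠ b·1)′` -/

section ArchPart

variable (L : Type) [Field L] [NumberField L] [IsCMField L] (N : ℕ) (H : Matrix (Fin N) (Fin N) L)

/-- **`(γ₀)_∞ = γ₀ ⊗ 1` in the `cmDatum` currency**: the matrix of `archPart (toAdelic γ₀)` is the entrywise mixed embedding of the matrix of `γ₀` (Mathlib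
`InfiniteAdeleRing.mixedEmbedding_eq_algebraMap_comp`; the generic-datum twin is ★ `archPart_toAdelic`). [cite: BorelJacquet1979, §4.1] -/
theorem coe_coe_archPart_cmDatum_toAdelic (γ₀ : (cmDatum L N H).Rational) :
    (((archPart (↥(maximalRealSubfield L)) L (IsCMField.complexConj L) N H ((cmDatum L N H).toAdelic γ₀) :
          arch (↥(maximalRealSubfield L)) L (IsCMField.complexConj L) N H) : GL (Fin N) (mixedSpace L)) : Matrix (Fin N) (Fin N) (mixedSpace L)) =
      ((γ₀.val : GL (Fin N) L) : Matrix (Fin N) (Fin N) L).map (mixedEmbedding L) := by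
  refine Matrix.ext fun i j => ?_
  show InfiniteAdeleRing.ringEquiv_mixedSpace L ((algebraMap L (AdeleRing (𝓞 L) L) (((γ₀.val : GL (Fin N) L) : Matrix (Fin N) (Fin N) L) i j)).1) =
    mixedEmbedding L (((γ₀.val : GL (Fin N) L) : Matrix (Fin N) (Fin N) L) i j)
  rw [InfiniteAdeleRing.mixedEmbedding_eq_algebraMap_comp]
  rfl

/-- **The block-model element**: if the matrix of `γ₀ ∈ U(Ha ⊕ᶠ Hb)(L⁺)` is `a·1₂ ⊕ᶠ b·1₁`, the matrix of `archPart (toAdelic γ₀) ∈ U(Ha ⊕ᶠ Hb)(L⁺ ⊗ ℝ)` is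
`(a ⊗ 1)·1₂ ⊕ᶠ (b ⊗ 1)·1₁` — the hypothesis `hγ` of §2 for Z1♭'s archimedean brick `centralizerTopFormHaar L (Ha ⊕ᶠ Hb) (archPart (toAdelic γ₀))`.
[cite: Rogawski1990, §3.8 Prop. 3.8.1 (a) p. 27] [cite: BorelJacquet1979, §4.1] -/
theorem coe_coe_archPart_cmDatum_toAdelic_of_eq_finSum (Ha : Matrix (Fin 2) (Fin 2) L) (Hb : Matrix (Fin 1) (Fin 1) L) {a b : L}
    (γ₀ : (cmDatum L 3 (finSum 2 1 Ha Hb)).Rational)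
    (hγ₀ : ((γ₀.val : GL (Fin 3) L) : Matrix (Fin 3) (Fin 3) L) = finSum 2 1 (a • (1 : Matrix (Fin 2) (Fin 2) L)) (b • 1)) :
    (((archPart (↥(maximalRealSubfield L)) L (IsCMField.complexConj L) 3 (finSum 2 1 Ha Hb) ((cmDatum L 3 (finSum 2 1 Ha Hb)).toAdelic γ₀) :
          arch (↥(maximalRealSubfield L)) L (IsCMField.complexConj L) 3 (finSum 2 1 Ha Hb)) : GL (Fin 3) (mixedSpace L)) : Matrix (Fin 3) (Fin 3) (mixedSpace L)) =
      finSum 2 1 (mixedEmbedding L a • (1 : Matrix (Fin 2) (Fin 2) (mixedSpace L))) (mixedEmbedding L b • 1) := by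
  rw [coe_coe_archPart_cmDatum_toAdelic, hγ₀, finSum_map]
  congr 1 <;>
    rw [Matrix.map_smul' _ _ _ (map_mul (mixedEmbedding L)), Matrix.map_one _ (map_zero _) (map_one _)]

end ArchPart

end UnitaryArchTopForm

end Literature.NumberTheory.Weil1964

end
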